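import Summits.KontsevichZagierPeriods.KontsevichZagierPeriods.Theses.ScissorsAvatars

/-!
# `Assembly` (stmt-KontsevichZagierPeriods-4266, route ScissorsAvatars) — proof

The route's assembly item `FiveTermScissors → DestabilisedScissors → Zeta31Scissors → MzvScissorsSector → OffSectorReduction → KontsevichZagierPeriods` is its
deciding theorem `closes` read as an implication. (lead c10 of crux 9129, banking)
-/

namespace Summit.KontsevichZagierPeriods.ScissorsAvatars

/-- **Assembly of route ScissorsAvatars** (stmt-KontsevichZagierPeriods-4266):
`FiveTermScissors → DestabilisedScissors → Zeta31Scissors → MzvScissorsSector → OffSectorReduction → KontsevichZagierPeriods` — the cruxes imply the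
summit, by the route's deciding theorem `closes`. [Kontsevich–Zagier 2001, §1.2] [folklore] -/
theorem assembly_proof :
    Summit.KontsevichZagierPeriods.KontsevichZagierPeriods.Theses.ScissorsAvatars.Assembly := by
  intro _ _ _ hS hO
  exact Summit.KontsevichZagierPeriods.KontsevichZagierPeriods.Theses.ScissorsAvatars.closes hS hO

end Summit.KontsevichZagierPeriods.ScissorsAvatars
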